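import Summits.BirchSwinnertonDyer.BirchSwinnertonDyer.Theses.PlecticLegs
import Literature.NumberTheory.EllipticCurves.Selmer
import Literature.NumberTheory.EllipticCurves.GaloisAction
import Literature.NumberTheory.EllipticCurves.SelmerCorankHolds
import Literature.Barriers.BirchSwinnertonDyer.SelmerVersusMordellWeilProofs
import HarnessLib

/-!
# Line `Sketch` — tightness / necessity lemmas around the registered skeleton (lead a1, 2026-08-17)

Companion of `Lines/Sketch.lean` (crux `PlecticLegs.PlecticPointsLB`, stmt-BirchSwinnertonDyer-17518). Sorry-free.

* `PlecticSelmerLB` — the Selmer-level target of the line (verbatim as in the skeleton; restated here so that this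
  file does not import a sorried skeleton).
* `StubPoints` — the statement of the wall stub D (`stub_points`), verbatim.
* `PlecticPointsLB_of_selmerLB` — the ideator's composition: `PlecticSelmerLB → StubPoints → PlecticPointsLB`.
* `plecticSelmerLB_of_plecticPointsLB` — NECESSITY of the Selmer stub: the crux implies `PlecticSelmerLB` (indeed
  `d ≤ s_p` at every prime), by the tree THEOREM `WeierstrassCurve.selmerCorank_eq_mordellWeilRank_add_holds`
  (`s_p = rank + corank Ш[p^∞]`). So A+B+C prove something the crux needs anyway; the line is a cut, not a detour.
* `stubPoints_iff_exists_shaCorank_eq_zero` — the wall stub D is EXACTLY "Ш(V/F)[p^∞] has corank 0 at one admissible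
  prime" (corank identity again; cf. `Literature.Barriers.BirchSwinnertonDyer.shaCorank_eq_zero_iff_selmerCorank_le_holds`).
* `plecticPointsLB_iff_selmerLB_and_points_of_UB` — under the sibling crux `PlecticRankUB` restricted to … (not
  claimed; see NOTES) — omitted.
-/

set_option linter.dupNamespace false

open NumberField IsDedekindDomain

namespace Summit.BirchSwinnertonDyer.BirchSwinnertonDyer.Cruxes.PlecticPointsLB.SketchTightness

open Summit.BirchSwinnertonDyer.BirchSwinnertonDyer.Theses.PlecticLegs

/-- The Selmer-level target of line `Sketch` (verbatim copy of `Lines/Sketch.lean`'s `PlecticSelmerLB`). -/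
def PlecticSelmerLB : Prop :=
  ∀ (F : Type) [Field F] [NumberField F] [NumberField.IsTotallyReal F] (V : WeierstrassCurve F)
    [V.IsElliptic] (p : ℕ) [Fact p.Prime], 5 ≤ p → ¬ ((p : ℤ) ∣ NumberField.discr F) →
    V.HasIrreducibleModPGaloisRep p →
    (∀ 𝔭 : HeightOneSpectrum (𝓞 F), (p : 𝓞 F) ∈ 𝔭.asIdeal →
      ((V.baseChange (𝔭.adicCompletion F)).localPolynomial (𝔭.adicCompletionIntegers F)).natDegree = 2 ∧
      ¬ (p : ℤ) ∣ ((V.baseChange (𝔭.adicCompletion F)).localPolynomial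
        (𝔭.adicCompletionIntegers F)).coeff 1) →
    2 ≤ Module.finrank ℚ F → V.analyticRank = Module.finrank ℚ F →
    Module.finrank ℚ F ≤ V.selmerCorank p

/-- The wall stub D of the line (verbatim signature of the registered `stub_points`). -/
def StubPoints : Prop :=
  ∀ (F : Type) [Field F] [NumberField F] [NumberField.IsTotallyReal F] (V : WeierstrassCurve F)
    [V.IsElliptic], 2 ≤ Module.finrank ℚ F → V.analyticRank = Module.finrank ℚ F →
    ∃ (p : ℕ) (_ : Fact p.Prime), 5 ≤ p ∧ ¬ ((p : ℤ) ∣ NumberField.discr F) ∧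
      V.HasIrreducibleModPGaloisRep p ∧
      (∀ 𝔭 : HeightOneSpectrum (𝓞 F), (p : 𝓞 F) ∈ 𝔭.asIdeal →
        ((V.baseChange (𝔭.adicCompletion F)).localPolynomial (𝔭.adicCompletionIntegers F)).natDegree = 2 ∧
        ¬ (p : ℤ) ∣ ((V.baseChange (𝔭.adicCompletion F)).localPolynomial
          (𝔭.adicCompletionIntegers F)).coeff 1) ∧
      V.selmerCorank p ≤ V.mordellWeilRank

/-- The wall stub with `s_p ≤ rank` replaced by `corank Ш(V/F)[p^∞] = 0`. -/
def StubShaCotorsion : Prop :=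
  ∀ (F : Type) [Field F] [NumberField F] [NumberField.IsTotallyReal F] (V : WeierstrassCurve F)
    [V.IsElliptic], 2 ≤ Module.finrank ℚ F → V.analyticRank = Module.finrank ℚ F →
    ∃ (p : ℕ) (_ : Fact p.Prime), 5 ≤ p ∧ ¬ ((p : ℤ) ∣ NumberField.discr F) ∧
      V.HasIrreducibleModPGaloisRep p ∧
      (∀ 𝔭 : HeightOneSpectrum (𝓞 F), (p : 𝓞 F) ∈ 𝔭.asIdeal →
        ((V.baseChange (𝔭.adicCompletion F)).localPolynomial (𝔭.adicCompletionIntegers F)).natDegree = 2 ∧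
        ¬ (p : ℤ) ∣ ((V.baseChange (𝔭.adicCompletion F)).localPolynomial
          (𝔭.adicCompletionIntegers F)).coeff 1) ∧
      V.shaCorank p = 0

/-- **The ideator's composition**: the Selmer-level target and the wall stub D imply the crux BY NAME —
D supplies an admissible `p` with `s_p ≤ rank`, the target gives `d ≤ s_p`. -/
theorem PlecticPointsLB_of_selmerLB (hS : PlecticSelmerLB) (hD : StubPoints) : PlecticPointsLB := by
  intro F _ _ _ V _ hd hran
  obtain ⟨p, hp, h5, hdisc, hirr, hord, hpts⟩ := hD F V hd hran
  haveI := hp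
  exact (hS F V p h5 hdisc hirr hord hd hran).trans hpts

/-- **Necessity of the Selmer-level target**: the crux implies `PlecticSelmerLB`, because
`s_p = rank + corank Ш[p^∞] ≥ rank ≥ d` (tree theorem `selmerCorank_eq_mordellWeilRank_add_holds`). -/
theorem plecticSelmerLB_of_plecticPointsLB (h : PlecticPointsLB) : PlecticSelmerLB := by
  intro F _ _ _ V _ p _ h5 hdisc hirr hord hd hran
  have hr := h F V hd hran
  have hs := V.selmerCorank_eq_mordellWeilRank_add_holds p
  omega

/-- **The wall stub is Ш-cotorsion at one admissible prime**: `StubPoints ↔ StubShaCotorsion`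
(pointwise `s_p ≤ rank ↔ corank Ш[p^∞] = 0`, by `s_p = rank + corank Ш[p^∞]`). -/
theorem stubPoints_iff_stubShaCotorsion : StubPoints ↔ StubShaCotorsion := by
  constructor
  · intro h F _ _ _ V _ hd hran
    obtain ⟨p, hp, h5, hdisc, hirr, hord, hpts⟩ := h F V hd hran
    haveI := hp
    have hs := V.selmerCorank_eq_mordellWeilRank_add_holds p
    exact ⟨p, hp, h5, hdisc, hirr, hord, by omega⟩
  · intro h F _ _ _ V _ hd hran
    obtain ⟨p, hp, h5, hdisc, hirr, hord, hsha⟩ := h F V hd hran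
    haveI := hp
    have hs := V.selmerCorank_eq_mordellWeilRank_add_holds p
    exact ⟨p, hp, h5, hdisc, hirr, hord, by omega⟩

/-- **Under the crux, the wall stub D is exactly "rank = s_p at one admissible prime"** — i.e. once LB holds, D is
the Selmer-level UPPER bound at one prime (the sibling crux `PlecticRankUB` in Selmer form there). Recorded to make
precise that D is independent of the LB crux: `crux ∧ D` says `d ≤ rank = s_p`, `crux` alone says nothing about Ш. -/
theorem stubPoints_iff_of_plecticPointsLB (h : PlecticPointsLB) :
    StubPoints ↔
      ∀ (F : Type) [Field F] [NumberField F] [NumberField.IsTotallyReal F] (V : WeierstrassCurve F)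
        [V.IsElliptic], 2 ≤ Module.finrank ℚ F → V.analyticRank = Module.finrank ℚ F →
        ∃ (p : ℕ) (_ : Fact p.Prime), 5 ≤ p ∧ ¬ ((p : ℤ) ∣ NumberField.discr F) ∧
          V.HasIrreducibleModPGaloisRep p ∧
          (∀ 𝔭 : HeightOneSpectrum (𝓞 F), (p : 𝓞 F) ∈ 𝔭.asIdeal →
            ((V.baseChange (𝔭.adicCompletion F)).localPolynomial
              (𝔭.adicCompletionIntegers F)).natDegree = 2 ∧
            ¬ (p : ℤ) ∣ ((V.baseChange (𝔭.adicCompletion F)).localPolynomial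
              (𝔭.adicCompletionIntegers F)).coeff 1) ∧
          V.selmerCorank p = V.mordellWeilRank ∧ Module.finrank ℚ F ≤ V.mordellWeilRank := by
  constructor
  · intro hD F _ _ _ V _ hd hran
    obtain ⟨p, hp, h5, hdisc, hirr, hord, hpts⟩ := hD F V hd hran
    haveI := hp
    have hs := V.selmerCorank_eq_mordellWeilRank_add_holds p
    have hr := h F V hd hran
    exact ⟨p, hp, h5, hdisc, hirr, hord, by omega, hr⟩
  · intro hD F _ _ _ V _ hd hran
    obtain ⟨p, hp, h5, hdisc, hirr, hord, heq, -⟩ := hD F V hd hran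
    exact ⟨p, hp, h5, hdisc, hirr, hord, heq.le⟩

end Summit.BirchSwinnertonDyer.BirchSwinnertonDyer.Cruxes.PlecticPointsLB.SketchTightness
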